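import Mathlib
import Summits.ValiantsHypothesis.ValiantsHypothesis.Theorems.NewtonUnitEquationsDissociatedUniformTotalsLaw
import Summits.ValiantsHypothesis.ValiantsHypothesis.Theorems.NewtonUnitEquationsDissociatedUniformTotalsLawUnion
import Summits.ValiantsHypothesis.ValiantsHypothesis.Theorems.NewtonUnitEquationsDissociatedUniformTotalsLawIntervalUnionLogRuns
import Summits.ValiantsHypothesis.ValiantsHypothesis.Theorems.NewtonUnitEquationsDissociatedUniformTotalsLawIntervalUnionArc
import HarnessLib

/-!
# Crux `NewtonUnitEquations.DissociatedUniform` (stmt-ValiantsHypothesis-5905), `n = 3` totals law of model (Q**):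
# unions of `r` cyclic arcs and third curves with few arc-runs — arbitrary finite abelian group, arbitrary pairs

Corollaries of `…TotalsLawIntervalUnionArc.unionVert_cycArc_le` (`#vert conv U_s(cycArc t d m) ≤ 40|G|` for ALL `a b : G → ℝ²`,
every arc `{t + i•d : i < m}` of any step in any finite abelian group `G`) and the subadditivity of fibre unions in the position
set (`…IntervalUnionLogRuns.unionVert_biUnion_le`):
* `unionVert_arcs_le` — a position set that is a union of `r` cyclic arcs (any base points, steps, lengths) has
  `#vert conv U_s(Z) ≤ r·40|G|` for every class; `unionTotal_arcs_le` — `≤ r·40|G|²` in total;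
* `classVert_le_of_arcRun_levels` / `totalVert_le_of_arcRun_levels` — a third curve with `≤ k` values, each level set a union of
  `≤ r` cyclic arcs, has `V_s ≤ k·r·40|G|` POINTWISE and `T(a,b,c) ≤ k·r·40|G|²`, for an ARBITRARY pair `a, b`.
Together with the coset stratum (`…TotalsLawUnionCosets`: `Z` a union of `r` cosets, `≤ 2r|G|`) and the co-small stratum
(`…TotalsLawExposure`), these are the structured position sets on which the pointwise union bound — false in general
(`…TotalsLawUnionVertLower`, `Θ(|G|^{4/3})`) — holds linearly.  Honest label: `UnionTotalsLaw C` and `TotalsLawThree C` remain OPEN and are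
asserted nowhere; nothing here bears on VP ≠ VNP. [folklore]
-/

set_option linter.dupNamespace false -- `ValiantsHypothesis.ValiantsHypothesis` (summit = problem) in every name

open Finset
open scoped Pointwise

namespace Summit.ValiantsHypothesis.ValiantsHypothesis.Theorems.NewtonUnitEquationsDissociatedUniform

namespace TotalsLaw

section ArcRuns

variable {G : Type*} [AddCommGroup G] [Fintype G] [DecidableEq G]

/-- **Unions of `r` cyclic arcs:** `#vert conv U_s(⋃_{i∈R} cycArc (t i) (d i) (m i)) ≤ |R|·40|G|` for all `a, b`, every class. -/
theorem unionVert_arcs_le {ι : Type*} (a b : G → (Fin 2 → ℝ)) (R : Finset ι) (t d : ι → G) (m : ι → ℕ) (s : G) :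
    unionVert a b (⋃ i ∈ R, (cycArc (t i) (d i) (m i) : Set G)) s ≤ R.card * (40 * Fintype.card G) := by
  calc _ ≤ ∑ i ∈ R, unionVert a b (cycArc (t i) (d i) (m i) : Set G) s := unionVert_biUnion_le a b R _ s
    _ ≤ ∑ _i ∈ R, 40 * Fintype.card G := Finset.sum_le_sum fun i _ => unionVert_cycArc_le a b (t i) (d i) (m i) s
    _ = R.card * (40 * Fintype.card G) := by rw [Finset.sum_const, smul_eq_mul]

/-- … and in total over the classes: `≤ |R|·40|G|²`. -/
theorem unionTotal_arcs_le {ι : Type*} (a b : G → (Fin 2 → ℝ)) (R : Finset ι) (t d : ι → G) (m : ι → ℕ) :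
    unionTotal a b (⋃ i ∈ R, (cycArc (t i) (d i) (m i) : Set G)) ≤ R.card * (40 * Fintype.card G ^ 2) := by
  unfold unionTotal
  calc _ ≤ ∑ _s : G, R.card * (40 * Fintype.card G) := Finset.sum_le_sum fun s _ => unionVert_arcs_le a b R t d m s
    _ = R.card * (40 * Fintype.card G ^ 2) := by rw [Finset.sum_const, Finset.card_univ, smul_eq_mul]; ring

/-- **The `n = 3` law, POINTWISE, for a third curve with few ARC-RUNS and an ARBITRARY pair (any finite abelian group):** if `c`
takes `≤ k` values and every level set of `c` is a union of `≤ r` cyclic arcs, then `V_s ≤ k·r·40|G|` for every class `s`. -/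
theorem classVert_le_of_arcRun_levels (a b c : G → (Fin 2 → ℝ)) [DecidableEq (Fin 2 → ℝ)] {k r : ℕ}
    (hk : (Finset.univ.image c).card ≤ k)
    (hc : ∀ v, ∃ R : Finset (G × G × ℕ), R.card ≤ r ∧
      c ⁻¹' {v} = ⋃ p ∈ R, (cycArc p.1 p.2.1 p.2.2 : Set G)) (s : G) :
    classVert a b c s ≤ k * (r * (40 * Fintype.card G)) := by
  calc classVert a b c s ≤ ∑ v ∈ Finset.univ.image c, unionVert a b (c ⁻¹' {v}) s :=
        classVert_le_sum_unionVert a b c s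
    _ ≤ ∑ _v ∈ Finset.univ.image c, r * (40 * Fintype.card G) :=
        Finset.sum_le_sum fun v _ => by
          obtain ⟨R, hR, h⟩ := hc v
          rw [h]
          exact (unionVert_arcs_le a b R (fun p => p.1) (fun p => p.2.1) (fun p => p.2.2) s).trans
            (Nat.mul_le_mul_right _ hR)
    _ ≤ k * (r * (40 * Fintype.card G)) := by
        rw [Finset.sum_const, smul_eq_mul]
        exact Nat.mul_le_mul_right _ hk

/-- **… and in TOTAL:** `T(a,b,c) ≤ k·r·40|G|²` for `a, b` arbitrary and `c` with `≤ k` values whose level sets are unions of `≤ r`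
cyclic arcs. -/
theorem totalVert_le_of_arcRun_levels (a b c : G → (Fin 2 → ℝ)) [DecidableEq (Fin 2 → ℝ)] {k r : ℕ}
    (hk : (Finset.univ.image c).card ≤ k)
    (hc : ∀ v, ∃ R : Finset (G × G × ℕ), R.card ≤ r ∧
      c ⁻¹' {v} = ⋃ p ∈ R, (cycArc p.1 p.2.1 p.2.2 : Set G)) :
    totalVert a b c ≤ k * (r * (40 * Fintype.card G ^ 2)) := by
  unfold totalVert
  calc ∑ s, classVert a b c s ≤ ∑ _s : G, k * (r * (40 * Fintype.card G)) :=
        Finset.sum_le_sum fun s _ => classVert_le_of_arcRun_levels a b c hk hc s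
    _ = k * (r * (40 * Fintype.card G ^ 2)) := by rw [Finset.sum_const, Finset.card_univ, smul_eq_mul]; ring

end ArcRuns

end TotalsLaw

end Summit.ValiantsHypothesis.ValiantsHypothesis.Theorems.NewtonUnitEquationsDissociatedUniform
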